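import Literature.Analysis.FluidPDE.NovackLongitudinalBalance
import Literature.Analysis.FluidPDE.NovackBallAvgLimitProofs
import Literature.Analysis.FluidPDE.WeightedBallAverageLimits
import Literature.Analysis.FluidPDE.BallMomentsAverages
import HarnessLib

/-!
# The limit `ℓ → 0` of Novack's longitudinal pairing — discharge of `novack2024_longAvg_balance_tendsto`

Sorry-free proof `Torus.novack2024_longAvg_balance_tendsto_holds` of the named fact
`Torus.novack2024_longAvg_balance_tendsto` of `Literature.Analysis.FluidPDE.NovackLongitudinalBalance`
(Novack 2024, §2 Step 2: "combining these results, and passing to the limit `ℓ → 0` in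
(last:one:L:L), we obtain that the left-hand side converges to `3d/(d(d+2))` multiplied by the
left-hand side of (eq:main:balance)", resting on the (claim)
`lim_{ℓ→0} ∫ |g_{L,ℓ} − (3/(d+2)) g|ᵖ = 0`): for a jointly measurable
`u ∈ L³((0,T) × T^d)`, `p ∈ L^{3/2}` and a test function `ψ` supported in `(0,T) × T^d`,
`𝒩^L_ℓ(ψ) → (3/(d+2)) ∫₀ᵀ∫ (2|u|²∂ₜψ + 2|u|²⟪u,∇ψ⟫ + 4p⟪u,∇ψ⟫)` as `ℓ → 0⁺`.

## Proof (as printed: masses + approximate identity, then Hölder pairings)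

The four averages of the combined kernel `M_ℓ(y) = |B_ℓ|⁻¹ 1_{B_ℓ}(y)[(1 − |y|²/ℓ²) 1 + y⊗y/ℓ²]`
are weighted ball averages with bounded linear weights, jointly continuous in `(y, v)`:

* `u_{L,ℓ} = ⨍_{B_ℓ} w^L_ℓ(y) u(x+y) dy`, `w^L_ℓ(y) v = (1 − |y|²/ℓ²) v + ℓ⁻² ⟪y, v⟫ y`, of mass
  `(2/(d+2) + 1/(d+2)) 1 = (3/(d+2)) 1` (`longWeight_mass`: `⨍_{B_ℓ} |y|² = dℓ²/(d+2)`,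
  `⨍_{B_ℓ} ⟪y,v⟫ y = ℓ² v/(d+2)`, `Literature.Analysis.FluidPDE.BallMomentsAverages`);
* `(|u_L|²)_ℓ`, `(u|u_L|²)_ℓ` are the same weights acting on the tensors `uᵢuⱼ` and `uᵢuⱼ u`
  through `w^⊗_ℓ(y) Φ = (1 − |y|²/ℓ²) ∑ᵢ Φᵢᵢ + ℓ⁻² ∑ᵢⱼ yᵢyⱼ Φᵢⱼ` (`tensorWeight_mass`: the
  second-moment matrix `⨍_{B_ℓ} yᵢyⱼ = δᵢⱼ ℓ²/(d+2)`), of mass `(3/(d+2)) tr`, and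
  `tr(u⊗u) = |u|²`;
* `p_{L,ℓ} = ⨍_{B_ℓ} [1 − ((d−1)/2)(1 − |y|²/ℓ²)] p(x+y) dy`, of mass
  `1 − ((d−1)/2)(2/(d+2)) = 3/(d+2)` (`pressureWeight_mass`).

Hence (`Torus.tendsto_lintegral_weightedBallAverage_sub` of
`Literature.Analysis.FluidPDE.WeightedBallAverageLimits`, the (claim) for a general bounded linear
weight) `u_{L,ℓ} → (3/(d+2)) u` in `L³((0,T) × T^d)`, `(|u_L|²)_ℓ → (3/(d+2))|u|²` in `L^{3/2}`,
`(u|u_L|²)_ℓ → (3/(d+2))|u|²u` in `L¹`, `p_{L,ℓ} → (3/(d+2)) p` in `L^{3/2}`; each of the six terms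
of `𝒩^L_ℓ(ψ)` is a weighted bilinear pairing of one convergent factor with a fixed factor in the
dual class, so it converges (`Torus.tendsto_integral_mul_bilin_of_tendsto_eLpNorm`, Hölder pairs
`(3, 3/2)`, `(1, ∞)`, `(3/2, 3)`), exactly as in the ball-kernel case
`Torus.novack2024_ballAvg_balance_tendsto_holds` (`NovackBallAvgLimitProofs`), whose bookkeeping is
repeated with the extra factor `3/(d+2)`.

## References

* M. Novack, *Scaling laws and exact results in turbulence*, Nonlinearity 37 (2024) 095002,
  arXiv:2310.01375, §2 Step 2 ((you:ell:ell), (claim), closing paragraph). [Novack2024]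
* G. B. Folland, *Real Analysis*, 2nd ed. (1999), Thm. 8.14 (a). [Folland1999]
-/

noncomputable section

open MeasureTheory TopologicalSpace Set Function Filter Metric
open _root_.Topology
open scoped InnerProductSpace RealInnerProductSpace ENNReal NNReal

namespace Literature.Analysis.FluidPDE

variable {d : Type*} [Fintype d]

/-! ## Linearity of set averages -/

section AverageHelpers

variable {α : Type*} [MeasurableSpace α] {μ : Measure α} {V : Type*} [NormedAddCommGroup V]
  [NormedSpace ℝ V] {s : Set α}

/-- Set averages are additive (on integrable functions). [folklore] -/
theorem setAverage_add {f g : α → V} (hf : IntegrableOn f s μ) (hg : IntegrableOn g s μ) :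
    ⨍ x in s, (f x + g x) ∂μ = (⨍ x in s, f x ∂μ) + ⨍ x in s, g x ∂μ := by
  rw [setAverage_eq, setAverage_eq, setAverage_eq, integral_add hf hg, smul_add]

/-- Set averages commute with finite sums (on integrable functions). [folklore] -/
theorem setAverage_finsetSum {ι : Type*} (t : Finset ι) {f : ι → α → V}
    (hf : ∀ i ∈ t, IntegrableOn (f i) s μ) :
    ⨍ x in s, ∑ i ∈ t, f i x ∂μ = ∑ i ∈ t, ⨍ x in s, f i x ∂μ := by
  rw [setAverage_eq, integral_finsetSum t hf, Finset.smul_sum]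
  exact Finset.sum_congr rfl fun i _ => (setAverage_eq _ _ _).symm

/-- `⨍ (f x • c) = (⨍ f) • c` for a real weight `f`. [folklore] -/
theorem setAverage_smul_const [CompleteSpace V] (f : α → ℝ) (c : V) :
    ⨍ x in s, f x • c ∂μ = (⨍ x in s, f x ∂μ) • c := by
  rw [setAverage_eq, setAverage_eq, integral_smul_const, smul_assoc]

/-- `⨍ (r • f x) = r • ⨍ f` for a real constant `r`. [folklore] -/
theorem setAverage_const_smul (r : ℝ) (f : α → V) :
    ⨍ x in s, r • f x ∂μ = r • ⨍ x in s, f x ∂μ := by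
  rw [setAverage_eq, setAverage_eq, integral_smul, smul_comm]

/-- `⨍ (r * f x) = r * ⨍ f` for a real constant `r`. [folklore] -/
theorem setAverage_const_mul (r : ℝ) (f : α → ℝ) :
    ⨍ x in s, r * f x ∂μ = r * ⨍ x in s, f x ∂μ := by
  rw [setAverage_eq, setAverage_eq, integral_const_mul, smul_eq_mul, smul_eq_mul]
  ring

/-- `⨍ (f x * r) = (⨍ f) * r` for a real constant `r`. [folklore] -/
theorem setAverage_mul_const (f : α → ℝ) (r : ℝ) :
    ⨍ x in s, f x * r ∂μ = (⨍ x in s, f x ∂μ) * r := by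
  rw [setAverage_eq, setAverage_eq, integral_mul_const, smul_eq_mul, smul_eq_mul]
  ring

/-- Set averages respect subtraction (on integrable functions). [folklore] -/
theorem setAverage_sub {f g : α → V} (hf : IntegrableOn f s μ) (hg : IntegrableOn g s μ) :
    ⨍ x in s, (f x - g x) ∂μ = (⨍ x in s, f x ∂μ) - ⨍ x in s, g x ∂μ := by
  rw [setAverage_eq, setAverage_eq, setAverage_eq, integral_sub hf hg, smul_sub]

end AverageHelpers

/-! ## The masses, bounds, linearity and continuity of Novack's longitudinal weights -/

section Kernels

variable [Nonempty d]

/-- **The scalar mass `⨍_{B_ℓ} (1 − |y|²/ℓ²) dy = 2/(d+2)`** (the radial part of the trace of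
Novack's combined kernel; `⨍_{B_ℓ} |y|² = dℓ²/(d+2)`). [cite: Novack2024, Sect. 2 Step 2 (claim)] -/
theorem setAverage_ball_one_sub_norm_sq_div {ℓ : ℝ} (hℓ : 0 < ℓ) :
    ⨍ y in ball (0 : EuclideanSpace ℝ d) ℓ, (1 - ‖y‖ ^ 2 / ℓ ^ 2) = 2 / ((Fintype.card d : ℝ) + 2) := by
  have hB0 : volume (ball (0 : EuclideanSpace ℝ d) ℓ) ≠ 0 := (measure_ball_pos volume _ hℓ).ne'
  have hBtop : volume (ball (0 : EuclideanSpace ℝ d) ℓ) ≠ ∞ := measure_ball_lt_top.ne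
  have hc : IntegrableOn (fun _ : EuclideanSpace ℝ d => (1 : ℝ)) (ball 0 ℓ) volume :=
    integrableOn_const hBtop
  have hn : IntegrableOn (fun y : EuclideanSpace ℝ d => ‖y‖ ^ 2 / ℓ ^ 2) (ball 0 ℓ) volume :=
    integrableOn_euclideanBall_of_continuous (by fun_prop) 0 ℓ
  rw [setAverage_sub hc hn, setAverage_const hB0 hBtop]
  simp_rw [div_eq_mul_inv]
  rw [setAverage_mul_const, setAverage_ball_norm_sq hℓ]
  have hd2 : (Fintype.card d : ℝ) + 2 ≠ 0 := by positivity
  field_simp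
  ring

/-- **The mass of Novack's longitudinal vector weight**:
`⨍_{B_ℓ} [(1 − |y|²/ℓ²) v + ℓ⁻² ⟪y, v⟫ y] dy = (3/(d+2)) v` — the masses `∫ |B_ℓ|⁻¹1_{B_ℓ} T_L = d⁻¹ 1`
and `∫ ζ_ℓ T_T = −(2(d−1)/(d(d+2))) 1` of the source, combined (`2/(d+2) + 1/(d+2) = 3/(d+2)`). [cite: Novack2024, Sect. 2 Step 2 (claim)] -/
theorem longWeight_mass {ℓ : ℝ} (hℓ : 0 < ℓ) (v : EuclideanSpace ℝ d) :
    ⨍ y in ball (0 : EuclideanSpace ℝ d) ℓ, ((1 - ‖y‖ ^ 2 / ℓ ^ 2) • v + (ℓ ^ 2)⁻¹ • ⟪y, v⟫ • y) =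
      (3 / ((Fintype.card d : ℝ) + 2)) • v := by
  have h1 : IntegrableOn (fun y : EuclideanSpace ℝ d => (1 - ‖y‖ ^ 2 / ℓ ^ 2) • v) (ball 0 ℓ) volume :=
    integrableOn_euclideanBall_of_continuous (by fun_prop) 0 ℓ
  have h2 : IntegrableOn (fun y : EuclideanSpace ℝ d => (ℓ ^ 2)⁻¹ • ⟪y, v⟫ • y) (ball 0 ℓ) volume :=
    integrableOn_euclideanBall_of_continuous (by fun_prop) 0 ℓ
  rw [setAverage_add h1 h2, setAverage_smul_const, setAverage_ball_one_sub_norm_sq_div hℓ,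
    setAverage_const_smul, setAverage_ball_inner_smul v hℓ, smul_smul, ← add_smul]
  congr 1
  have hd2 : (Fintype.card d : ℝ) + 2 ≠ 0 := by positivity
  field_simp
  ring

omit [Nonempty d] in
/-- The longitudinal vector weight is bounded by `2` on `B_ℓ`:
`‖(1 − |y|²/ℓ²) v + ℓ⁻² ⟪y, v⟫ y‖ ≤ 2 ‖v‖` for `|y| < ℓ`. [folklore] -/
theorem norm_longWeight_le {ℓ : ℝ} (hℓ : 0 < ℓ) {y : EuclideanSpace ℝ d}
    (hy : y ∈ ball (0 : EuclideanSpace ℝ d) ℓ) (v : EuclideanSpace ℝ d) :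
    ‖(1 - ‖y‖ ^ 2 / ℓ ^ 2) • v + (ℓ ^ 2)⁻¹ • ⟪y, v⟫ • y‖ ≤ 2 * ‖v‖ := by
  have hyℓ : ‖y‖ < ℓ := mem_ball_zero_iff.1 hy
  have hr1 : ‖y‖ ^ 2 / ℓ ^ 2 ≤ 1 := by
    rw [div_le_one (by positivity)]
    exact pow_le_pow_left₀ (norm_nonneg _) hyℓ.le 2
  have hr0 : 0 ≤ ‖y‖ ^ 2 / ℓ ^ 2 := by positivity
  calc ‖(1 - ‖y‖ ^ 2 / ℓ ^ 2) • v + (ℓ ^ 2)⁻¹ • ⟪y, v⟫ • y‖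
      ≤ ‖(1 - ‖y‖ ^ 2 / ℓ ^ 2) • v‖ + ‖(ℓ ^ 2)⁻¹ • ⟪y, v⟫ • y‖ := norm_add_le _ _
    _ ≤ ‖v‖ + ‖v‖ := by
        refine add_le_add ?_ ?_
        · rw [norm_smul, Real.norm_eq_abs, abs_of_nonneg (by linarith)]
          exact mul_le_of_le_one_left (norm_nonneg _) (by linarith)
        · rw [norm_smul, norm_smul, Real.norm_eq_abs, Real.norm_eq_abs, abs_of_nonneg (by positivity)]
          calc (ℓ ^ 2)⁻¹ * (|⟪y, v⟫| * ‖y‖) ≤ (ℓ ^ 2)⁻¹ * (‖y‖ * ‖v‖ * ‖y‖) := by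
                gcongr
                exact abs_real_inner_le_norm _ _
            _ = ‖y‖ ^ 2 / ℓ ^ 2 * ‖v‖ := by ring
            _ ≤ 1 * ‖v‖ := by gcongr
            _ = ‖v‖ := one_mul _
    _ = 2 * ‖v‖ := by ring

omit [Nonempty d] in
/-- The longitudinal vector weight is linear. [folklore] -/
theorem longWeight_sub (ℓ : ℝ) (y a b : EuclideanSpace ℝ d) :
    (1 - ‖y‖ ^ 2 / ℓ ^ 2) • (a - b) + (ℓ ^ 2)⁻¹ • ⟪y, a - b⟫ • y =
      ((1 - ‖y‖ ^ 2 / ℓ ^ 2) • a + (ℓ ^ 2)⁻¹ • ⟪y, a⟫ • y) -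
        ((1 - ‖y‖ ^ 2 / ℓ ^ 2) • b + (ℓ ^ 2)⁻¹ • ⟪y, b⟫ • y) := by
  simp only [inner_sub_right, smul_sub, sub_smul, one_smul]
  abel

omit [Nonempty d] in
/-- The longitudinal vector weight is jointly continuous in `(y, v)`. [folklore] -/
theorem continuous_longWeight (ℓ : ℝ) :
    Continuous fun p : EuclideanSpace ℝ d × EuclideanSpace ℝ d =>
      (1 - ‖p.1‖ ^ 2 / ℓ ^ 2) • p.2 + (ℓ ^ 2)⁻¹ • ⟪p.1, p.2⟫ • p.1 := by
  fun_prop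

variable {V : Type*} [NormedAddCommGroup V] [NormedSpace ℝ V]

omit [Nonempty d] in
/-- Integrability on balls of the entries of the tensor weight. [folklore] -/
theorem integrableOn_ball_apply_mul_apply_smul (i j : d) (c : V) (ℓ : ℝ) :
    IntegrableOn (fun y : EuclideanSpace ℝ d => (y i * y j) • c) (ball 0 ℓ) volume :=
  integrableOn_euclideanBall_of_continuous (((PiLp.continuous_apply 2 (fun _ : d => ℝ) i).fun_mul
    (PiLp.continuous_apply 2 (fun _ : d => ℝ) j)).fun_smul continuous_const) 0 ℓ

/-- **The mass of Novack's combined kernel acting on tensors**: for `Φ : d → d → V`,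
`⨍_{B_ℓ} [(1 − |y|²/ℓ²) ∑ᵢ Φᵢᵢ + ℓ⁻² ∑ᵢⱼ yᵢyⱼ Φᵢⱼ] dy = (3/(d+2)) ∑ᵢ Φᵢᵢ` (the second-moment
matrix `⨍_{B_ℓ} yᵢyⱼ = δᵢⱼ ℓ²/(d+2)`). [cite: Novack2024, Sect. 2 Step 2 (claim)] -/
theorem tensorWeight_mass [CompleteSpace V] [DecidableEq d] {ℓ : ℝ} (hℓ : 0 < ℓ) (Φ : d → d → V) :
    ⨍ y in ball (0 : EuclideanSpace ℝ d) ℓ,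
        ((1 - ‖y‖ ^ 2 / ℓ ^ 2) • (∑ i, Φ i i) + (ℓ ^ 2)⁻¹ • ∑ i, ∑ j, (y i * y j) • Φ i j) =
      (3 / ((Fintype.card d : ℝ) + 2)) • ∑ i, Φ i i := by
  have hI : ∀ i j, IntegrableOn (fun y : EuclideanSpace ℝ d => (y i * y j) • Φ i j) (ball 0 ℓ) volume :=
    fun i j => integrableOn_ball_apply_mul_apply_smul i j (Φ i j) ℓ
  have hrow : ∀ i, IntegrableOn (fun y : EuclideanSpace ℝ d => ∑ j, (y i * y j) • Φ i j) (ball 0 ℓ)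
      volume := fun i => integrable_finsetSum _ fun j _ => hI i j
  have hall : IntegrableOn (fun y : EuclideanSpace ℝ d => ∑ i, ∑ j, (y i * y j) • Φ i j) (ball 0 ℓ)
      volume := integrable_finsetSum _ fun i _ => hrow i
  have h1 : IntegrableOn (fun y : EuclideanSpace ℝ d => (1 - ‖y‖ ^ 2 / ℓ ^ 2) • ∑ i, Φ i i) (ball 0 ℓ)
      volume := integrableOn_euclideanBall_of_continuous (by fun_prop) 0 ℓ
  have h2 : IntegrableOn (fun y : EuclideanSpace ℝ d => (ℓ ^ 2)⁻¹ • ∑ i, ∑ j, (y i * y j) • Φ i j)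
      (ball 0 ℓ) volume := hall.smul _
  have hmom : ⨍ y in ball (0 : EuclideanSpace ℝ d) ℓ, ∑ i, ∑ j, (y i * y j) • Φ i j =
      (ℓ ^ 2 / ((Fintype.card d : ℝ) + 2)) • ∑ i, Φ i i := by
    rw [setAverage_finsetSum _ fun i _ => hrow i, Finset.smul_sum]
    refine Finset.sum_congr rfl fun i _ => ?_
    rw [setAverage_finsetSum _ fun j _ => hI i j]
    simp_rw [setAverage_smul_const, setAverage_ball_apply_mul_apply _ _ hℓ, ite_smul, zero_smul,
      Finset.sum_ite_eq, Finset.mem_univ, if_true]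
  rw [setAverage_add h1 h2, setAverage_smul_const, setAverage_ball_one_sub_norm_sq_div hℓ,
    setAverage_const_smul, hmom, smul_smul, ← add_smul]
  congr 1
  have hd2 : (Fintype.card d : ℝ) + 2 ≠ 0 := by positivity
  field_simp
  ring

omit [Nonempty d] in
/-- The tensor weight is bounded on `B_ℓ`: `‖(1 − |y|²/ℓ²) ∑ᵢ Φᵢᵢ + ℓ⁻² ∑ᵢⱼ yᵢyⱼ Φᵢⱼ‖ ≤ (d + d²) ‖Φ‖`
for `|y| < ℓ`. [folklore] -/
theorem norm_tensorWeight_le {ℓ : ℝ} (hℓ : 0 < ℓ) {y : EuclideanSpace ℝ d}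
    (hy : y ∈ ball (0 : EuclideanSpace ℝ d) ℓ) (Φ : d → d → V) :
    ‖(1 - ‖y‖ ^ 2 / ℓ ^ 2) • (∑ i, Φ i i) + (ℓ ^ 2)⁻¹ • ∑ i, ∑ j, (y i * y j) • Φ i j‖ ≤
      ((Fintype.card d : ℝ) + (Fintype.card d : ℝ) ^ 2) * ‖Φ‖ := by
  have hyℓ : ‖y‖ < ℓ := mem_ball_zero_iff.1 hy
  have hr1 : ‖y‖ ^ 2 / ℓ ^ 2 ≤ 1 := by
    rw [div_le_one (by positivity)]
    exact pow_le_pow_left₀ (norm_nonneg _) hyℓ.le 2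
  have hr0 : 0 ≤ ‖y‖ ^ 2 / ℓ ^ 2 := by positivity
  have hΦij : ∀ i j, ‖Φ i j‖ ≤ ‖Φ‖ := fun i j => (norm_le_pi_norm (Φ i) j).trans (norm_le_pi_norm Φ i)
  have hyi : ∀ i, |y i| ≤ ‖y‖ := fun i => by
    have h := PiLp.norm_apply_le y i
    rwa [Real.norm_eq_abs] at h
  have htr : ‖∑ i, Φ i i‖ ≤ (Fintype.card d : ℝ) * ‖Φ‖ := by
    calc ‖∑ i, Φ i i‖ ≤ ∑ i, ‖Φ i i‖ := norm_sum_le _ _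
      _ ≤ ∑ _i : d, ‖Φ‖ := Finset.sum_le_sum fun i _ => hΦij i i
      _ = (Fintype.card d : ℝ) * ‖Φ‖ := by simp
  have hsec : ‖∑ i, ∑ j, (y i * y j) • Φ i j‖ ≤ (Fintype.card d : ℝ) ^ 2 * (‖y‖ ^ 2 * ‖Φ‖) := by
    calc ‖∑ i, ∑ j, (y i * y j) • Φ i j‖ ≤ ∑ i, ‖∑ j, (y i * y j) • Φ i j‖ := norm_sum_le _ _
      _ ≤ ∑ i, ∑ j, ‖(y i * y j) • Φ i j‖ := Finset.sum_le_sum fun i _ => norm_sum_le _ _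
      _ ≤ ∑ _i : d, ∑ _j : d, ‖y‖ ^ 2 * ‖Φ‖ := by
          refine Finset.sum_le_sum fun i _ => Finset.sum_le_sum fun j _ => ?_
          rw [norm_smul, norm_mul, Real.norm_eq_abs, Real.norm_eq_abs, sq]
          exact mul_le_mul (mul_le_mul (hyi i) (hyi j) (abs_nonneg _) (norm_nonneg _)) (hΦij i j)
            (norm_nonneg _) (by positivity)
      _ = (Fintype.card d : ℝ) ^ 2 * (‖y‖ ^ 2 * ‖Φ‖) := by simp [sq, mul_assoc]
  calc ‖(1 - ‖y‖ ^ 2 / ℓ ^ 2) • (∑ i, Φ i i) + (ℓ ^ 2)⁻¹ • ∑ i, ∑ j, (y i * y j) • Φ i j‖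
      ≤ ‖(1 - ‖y‖ ^ 2 / ℓ ^ 2) • ∑ i, Φ i i‖ + ‖(ℓ ^ 2)⁻¹ • ∑ i, ∑ j, (y i * y j) • Φ i j‖ :=
        norm_add_le _ _
    _ ≤ (Fintype.card d : ℝ) * ‖Φ‖ + (Fintype.card d : ℝ) ^ 2 * ‖Φ‖ := by
        refine add_le_add ?_ ?_
        · rw [norm_smul, Real.norm_eq_abs, abs_of_nonneg (by linarith)]
          exact (mul_le_of_le_one_left (norm_nonneg _) (by linarith)).trans htr
        · rw [norm_smul, Real.norm_eq_abs, abs_of_nonneg (by positivity)]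
          calc (ℓ ^ 2)⁻¹ * ‖∑ i, ∑ j, (y i * y j) • Φ i j‖
              ≤ (ℓ ^ 2)⁻¹ * ((Fintype.card d : ℝ) ^ 2 * (‖y‖ ^ 2 * ‖Φ‖)) := by gcongr
            _ = (Fintype.card d : ℝ) ^ 2 * (‖y‖ ^ 2 / ℓ ^ 2) * ‖Φ‖ := by ring
            _ ≤ (Fintype.card d : ℝ) ^ 2 * 1 * ‖Φ‖ := by gcongr
            _ = (Fintype.card d : ℝ) ^ 2 * ‖Φ‖ := by ring
    _ = ((Fintype.card d : ℝ) + (Fintype.card d : ℝ) ^ 2) * ‖Φ‖ := by ring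

omit [Nonempty d] in
/-- The tensor weight is linear. [folklore] -/
theorem tensorWeight_sub (ℓ : ℝ) (y : EuclideanSpace ℝ d) (Φ Ψ : d → d → V) :
    (1 - ‖y‖ ^ 2 / ℓ ^ 2) • (∑ i, (Φ - Ψ) i i) + (ℓ ^ 2)⁻¹ • ∑ i, ∑ j, (y i * y j) • (Φ - Ψ) i j =
      ((1 - ‖y‖ ^ 2 / ℓ ^ 2) • (∑ i, Φ i i) + (ℓ ^ 2)⁻¹ • ∑ i, ∑ j, (y i * y j) • Φ i j) -
        ((1 - ‖y‖ ^ 2 / ℓ ^ 2) • (∑ i, Ψ i i) + (ℓ ^ 2)⁻¹ • ∑ i, ∑ j, (y i * y j) • Ψ i j) := by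
  simp only [Pi.sub_apply, Finset.sum_sub_distrib, smul_sub]
  abel

omit [Nonempty d] in
/-- The tensor weight is jointly continuous in `(y, Φ)`. [folklore] -/
theorem continuous_tensorWeight (ℓ : ℝ) :
    Continuous fun p : EuclideanSpace ℝ d × (d → d → V) =>
      (1 - ‖p.1‖ ^ 2 / ℓ ^ 2) • (∑ i, p.2 i i) + (ℓ ^ 2)⁻¹ • ∑ i, ∑ j, (p.1 i * p.1 j) • p.2 i j := by
  have hap : ∀ i j, Continuous fun p : EuclideanSpace ℝ d × (d → d → V) => p.2 i j := fun i j => by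
    fun_prop
  have hco : ∀ i, Continuous fun p : EuclideanSpace ℝ d × (d → d → V) => p.1 i := fun i =>
    (PiLp.continuous_apply 2 (fun _ : d => ℝ) i).comp continuous_fst
  refine Continuous.add ?_ ?_
  · exact ((continuous_const.sub ((continuous_fst.norm.pow 2).div_const _)).fun_smul
      (continuous_finsetSum _ fun i _ => hap i i))
  · exact continuous_const.fun_smul (continuous_finsetSum _ fun i _ =>
      continuous_finsetSum _ fun j _ => ((hco i).fun_mul (hco j)).fun_smul (hap i j))

/-- **The mass of Novack's longitudinal pressure weight**:
`⨍_{B_ℓ} [1 − ((d−1)/2)(1 − |y|²/ℓ²)] dy · a = (3/(d+2)) a` (`1 − ((d−1)/2)(2/(d+2)) = 3/(d+2)`; the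
compactly supported potential `ζ̃_ℓ` of the combined kernel, "computing similarly for
`p_{L,ℓ}`"). [cite: Novack2024, Sect. 2 Step 2 (claim)] -/
theorem pressureWeight_mass {ℓ : ℝ} (hℓ : 0 < ℓ) (a : ℝ) :
    ⨍ y in ball (0 : EuclideanSpace ℝ d) ℓ,
        (1 - ((Fintype.card d : ℝ) - 1) / 2 * (1 - ‖y‖ ^ 2 / ℓ ^ 2)) * a =
      3 / ((Fintype.card d : ℝ) + 2) * a := by
  have hB0 : volume (ball (0 : EuclideanSpace ℝ d) ℓ) ≠ 0 := (measure_ball_pos volume _ hℓ).ne'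
  have hBtop : volume (ball (0 : EuclideanSpace ℝ d) ℓ) ≠ ∞ := measure_ball_lt_top.ne
  have hc : IntegrableOn (fun _ : EuclideanSpace ℝ d => (1 : ℝ)) (ball 0 ℓ) volume :=
    integrableOn_const hBtop
  have hn : IntegrableOn (fun y : EuclideanSpace ℝ d =>
      ((Fintype.card d : ℝ) - 1) / 2 * (1 - ‖y‖ ^ 2 / ℓ ^ 2)) (ball 0 ℓ) volume :=
    integrableOn_euclideanBall_of_continuous (by fun_prop) 0 ℓ
  rw [setAverage_mul_const, setAverage_sub hc hn, setAverage_const hB0 hBtop, setAverage_const_mul,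
    setAverage_ball_one_sub_norm_sq_div hℓ]
  have hd2 : (Fintype.card d : ℝ) + 2 ≠ 0 := by positivity
  field_simp
  ring

omit [Nonempty d] in
/-- The pressure weight is bounded on `B_ℓ`:
`|1 − ((d−1)/2)(1 − |y|²/ℓ²)| |a| ≤ (1 + |(d−1)/2|) |a|` for `|y| < ℓ`. [folklore] -/
theorem norm_pressureWeight_le {ℓ : ℝ} (hℓ : 0 < ℓ) {y : EuclideanSpace ℝ d}
    (hy : y ∈ ball (0 : EuclideanSpace ℝ d) ℓ) (a : ℝ) :
    ‖(1 - ((Fintype.card d : ℝ) - 1) / 2 * (1 - ‖y‖ ^ 2 / ℓ ^ 2)) * a‖ ≤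
      (1 + |((Fintype.card d : ℝ) - 1) / 2|) * ‖a‖ := by
  have hyℓ : ‖y‖ < ℓ := mem_ball_zero_iff.1 hy
  have hr1 : ‖y‖ ^ 2 / ℓ ^ 2 ≤ 1 := by
    rw [div_le_one (by positivity)]
    exact pow_le_pow_left₀ (norm_nonneg _) hyℓ.le 2
  have hr0 : 0 ≤ ‖y‖ ^ 2 / ℓ ^ 2 := by positivity
  rw [norm_mul]
  refine mul_le_mul_of_nonneg_right ?_ (norm_nonneg _)
  rw [Real.norm_eq_abs]
  calc |1 - ((Fintype.card d : ℝ) - 1) / 2 * (1 - ‖y‖ ^ 2 / ℓ ^ 2)|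
      ≤ |(1 : ℝ)| + |((Fintype.card d : ℝ) - 1) / 2 * (1 - ‖y‖ ^ 2 / ℓ ^ 2)| := abs_sub _ _
    _ = 1 + |((Fintype.card d : ℝ) - 1) / 2| * |1 - ‖y‖ ^ 2 / ℓ ^ 2| := by rw [abs_one, abs_mul]
    _ ≤ 1 + |((Fintype.card d : ℝ) - 1) / 2| * 1 := by
        gcongr
        rw [abs_of_nonneg (by linarith)]
        linarith
    _ = 1 + |((Fintype.card d : ℝ) - 1) / 2| := by ring

end Kernels

/-! ## The tensor weight on the quadratic and cubic tensors of `u` -/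

section Tensors

/-- On the quadratic tensor `Φᵢⱼ = uᵢuⱼ` the tensor weight is the integrand of `(|u_L|²)_ℓ`:
`(1 − |y|²/ℓ²) ∑ᵢ uᵢ² + ℓ⁻² ∑ᵢⱼ yᵢyⱼuᵢuⱼ = (1 − |y|²/ℓ²)|u|² + ℓ⁻² ⟪y, u⟫²`. [folklore] -/
theorem tensorWeight_apply_sq (ℓ : ℝ) (y u : EuclideanSpace ℝ d) :
    (1 - ‖y‖ ^ 2 / ℓ ^ 2) • (∑ i, u i * u i) + (ℓ ^ 2)⁻¹ • ∑ i, ∑ j, (y i * y j) • (u i * u j) =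
      (1 - ‖y‖ ^ 2 / ℓ ^ 2) * ‖u‖ ^ 2 + (ℓ ^ 2)⁻¹ * ⟪y, u⟫ ^ 2 := by
  have h1 : ∑ i, u i * u i = ‖u‖ ^ 2 := by
    rw [EuclideanSpace.real_norm_sq_eq]
    exact Finset.sum_congr rfl fun i _ => (sq (u i)).symm
  have h2 : ∑ i, ∑ j, (y i * y j) • (u i * u j) = ⟪y, u⟫ ^ 2 := by
    rw [real_inner_euclidean_eq_sum, sq, Finset.sum_mul_sum]
    refine Finset.sum_congr rfl fun i _ => Finset.sum_congr rfl fun j _ => ?_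
    rw [smul_eq_mul]
    ring
  rw [h1, h2, smul_eq_mul, smul_eq_mul]

/-- The trace of the quadratic tensor is `|u|²`: `(3/(d+2)) ∑ᵢ uᵢ² = (3/(d+2)) |u|²`. [folklore] -/
theorem trace_sq_smul (c : ℝ) (u : EuclideanSpace ℝ d) : c • (∑ i, u i * u i) = c * ‖u‖ ^ 2 := by
  rw [smul_eq_mul, EuclideanSpace.real_norm_sq_eq]
  congr 1
  exact Finset.sum_congr rfl fun i _ => (sq (u i)).symm

/-- On the cubic tensor `Φᵢⱼ = uᵢuⱼ u` the tensor weight is the integrand of `(u|u_L|²)_ℓ`: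
`(1 − |y|²/ℓ²) ∑ᵢ uᵢ² u + ℓ⁻² ∑ᵢⱼ yᵢyⱼuᵢuⱼ u = [(1 − |y|²/ℓ²)|u|² + ℓ⁻² ⟪y, u⟫²] u`. [folklore] -/
theorem tensorWeight_apply_cube (ℓ : ℝ) (y u : EuclideanSpace ℝ d) :
    (1 - ‖y‖ ^ 2 / ℓ ^ 2) • (∑ i, (u i * u i) • u) + (ℓ ^ 2)⁻¹ • ∑ i, ∑ j, (y i * y j) • (u i * u j) • u =
      ((1 - ‖y‖ ^ 2 / ℓ ^ 2) * ‖u‖ ^ 2 + (ℓ ^ 2)⁻¹ * ⟪y, u⟫ ^ 2) • u := by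
  have h1 : ∑ i, (u i * u i) • u = ‖u‖ ^ 2 • u := by
    rw [← Finset.sum_smul, EuclideanSpace.real_norm_sq_eq]
    congr 1
    exact Finset.sum_congr rfl fun i _ => (sq (u i)).symm
  have h2 : ∑ i, ∑ j, (y i * y j) • (u i * u j) • u = ⟪y, u⟫ ^ 2 • u := by
    simp_rw [smul_smul, ← Finset.sum_smul]
    congr 1
    rw [real_inner_euclidean_eq_sum, sq, Finset.sum_mul_sum]
    exact Finset.sum_congr rfl fun i _ => Finset.sum_congr rfl fun j _ => by ring
  rw [h1, h2, smul_smul, smul_smul, ← add_smul]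

/-- The trace of the cubic tensor is `|u|² u`. [folklore] -/
theorem trace_cube_smul (c : ℝ) (u : EuclideanSpace ℝ d) :
    c • (∑ i, (u i * u i) • u) = c • ‖u‖ ^ 2 • u := by
  congr 1
  rw [← Finset.sum_smul, EuclideanSpace.real_norm_sq_eq]
  congr 1
  exact Finset.sum_congr rfl fun i _ => (sq (u i)).symm

/-- The quadratic tensor is dominated by `|u|²` (sup norm). [folklore] -/
theorem norm_sqTensor_le (u : EuclideanSpace ℝ d) : ‖fun i j => u i * u j‖ ≤ ‖u‖ ^ 2 := by
  refine (pi_norm_le_iff_of_nonneg (by positivity)).2 fun i => ?_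
  refine (pi_norm_le_iff_of_nonneg (by positivity)).2 fun j => ?_
  rw [norm_mul, sq]
  exact mul_le_mul (PiLp.norm_apply_le u i) (PiLp.norm_apply_le u j) (norm_nonneg _) (norm_nonneg _)

/-- The cubic tensor is dominated by `|u|³` (sup norm). [folklore] -/
theorem norm_cubeTensor_le (u : EuclideanSpace ℝ d) :
    ‖fun i j => (u i * u j) • u‖ ≤ ‖u‖ ^ 2 * ‖u‖ := by
  refine (pi_norm_le_iff_of_nonneg (by positivity)).2 fun i => ?_
  refine (pi_norm_le_iff_of_nonneg (by positivity)).2 fun j => ?_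
  rw [norm_smul, norm_mul, sq]
  exact mul_le_mul_of_nonneg_right (mul_le_mul (PiLp.norm_apply_le u i) (PiLp.norm_apply_le u j)
    (norm_nonneg _) (norm_nonneg _)) (norm_nonneg _)

/-- The traced tensor `Φ ↦ c • ∑ᵢ Φᵢᵢ` is continuous. [folklore] -/
theorem continuous_const_smul_trace {V : Type*} [NormedAddCommGroup V] [NormedSpace ℝ V] (c : ℝ) :
    Continuous fun Φ : d → d → V => c • ∑ i, Φ i i :=
  continuous_const.fun_smul (continuous_finsetSum _ fun i _ => by fun_prop)

omit [Fintype d] in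
/-- The quadratic tensor depends continuously on `u`. [folklore] -/
theorem continuous_sqTensor :
    Continuous fun u : EuclideanSpace ℝ d => (fun i j => u i * u j : d → d → ℝ) :=
  continuous_pi fun i => continuous_pi fun j =>
    (PiLp.continuous_apply 2 (fun _ : d => ℝ) i).fun_mul (PiLp.continuous_apply 2 (fun _ : d => ℝ) j)

/-- The cubic tensor depends continuously on `u`. [folklore] -/
theorem continuous_cubeTensor :
    Continuous fun u : EuclideanSpace ℝ d => (fun i j => (u i * u j) • u : d → d → EuclideanSpace ℝ d) :=
  continuous_pi fun i => continuous_pi fun j =>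
    ((PiLp.continuous_apply 2 (fun _ : d => ℝ) i).fun_mul
      (PiLp.continuous_apply 2 (fun _ : d => ℝ) j)).fun_smul continuous_id

end Tensors

end Literature.Analysis.FluidPDE

namespace Literature.Analysis.FluidPDE.Torus

variable {d : Type*} [Fintype d]

/-! ## `L^p` packaging of weighted ball averages on `(0,T) × T^d` -/

section Packaging

variable {T : ℝ} {F G : Type*} [NormedAddCommGroup F] [NormedAddCommGroup G] [NormedSpace ℝ G]
  {u : ℝ → UnitAddTorus d → F}

/-- Weighted ball averages of an `L^q` field are in `L^q((0,T) × T^d)` (`q ≥ 1`, `ℓ > 0`;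
`Torus.lintegral_weightedBallAverage_rpow_le`). [folklore] -/
theorem memLp_uncurry_weightedBallAverage [Nonempty d] {q : ℝ} (hq : 1 ≤ q)
    (hu : MemLp (uncurry u) (ENNReal.ofReal q) ((volume.restrict (Ioo 0 T)).prod volume))
    {w : EuclideanSpace ℝ d → F → G} {C ℓ : ℝ} (hℓ : 0 < ℓ) (hC : 0 ≤ C)
    (hw_cont : Continuous fun p : EuclideanSpace ℝ d × F => w p.1 p.2)
    (hw_bd : ∀ y ∈ ball (0 : EuclideanSpace ℝ d) ℓ, ∀ v, ‖w y v‖ ≤ C * ‖v‖) :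
    MemLp (uncurry fun t x => ⨍ y in ball (0 : EuclideanSpace ℝ d) ℓ,
        w y (u t (x + FunctionSpaces.Torus.proj y))) (ENNReal.ofReal q)
      ((volume.restrict (Ioo 0 T)).prod volume) := by
  have hq0 : 0 < q := one_pos.trans_le hq
  refine ⟨aestronglyMeasurable_weightedBallAverage hu.1 hw_cont _, ?_⟩
  have h := hu.2
  rw [← ENNReal.rpow_lt_top_iff_of_pos hq0, ← lintegral_enorm_rpow_eq_eLpNorm_rpow hq0] at h ⊢
  exact (lintegral_weightedBallAverage_rpow_le hq hu.1 hℓ hC hw_cont hw_bd).trans_lt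
    (ENNReal.mul_lt_top (ENNReal.rpow_lt_top_of_nonneg hq0.le ENNReal.ofReal_ne_top) h)

/-- Weighted ball averages converge in `L^q((0,T) × T^d)` (`eLpNorm`/`MemLp` form of
`Torus.tendsto_lintegral_weightedBallAverage_sub` on the product). [folklore] -/
theorem tendsto_eLpNorm_weightedBallAverage_sub [Nonempty d] {q : ℝ} (hq : 1 ≤ q)
    (hu : MemLp (uncurry u) (ENNReal.ofReal q) ((volume.restrict (Ioo 0 T)).prod volume))
    {w : ℝ → EuclideanSpace ℝ d → F → G} {L : F → G} {C ℓ₀ : ℝ} (hℓ₀ : 0 < ℓ₀) (hC : 0 ≤ C)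
    (hL : Continuous L)
    (hw_sub : ∀ ℓ y a b, w ℓ y (a - b) = w ℓ y a - w ℓ y b)
    (hw_cont : ∀ ℓ, Continuous fun p : EuclideanSpace ℝ d × F => w ℓ p.1 p.2)
    (hw_bd : ∀ ℓ ∈ Ioo 0 ℓ₀, ∀ y ∈ ball (0 : EuclideanSpace ℝ d) ℓ, ∀ v, ‖w ℓ y v‖ ≤ C * ‖v‖)
    (hw_mass : ∀ ℓ ∈ Ioo 0 ℓ₀, ∀ v, ⨍ y in ball (0 : EuclideanSpace ℝ d) ℓ, w ℓ y v = L v) :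
    Tendsto (fun ℓ : ℝ => eLpNorm
        ((uncurry fun t x => ⨍ y in ball (0 : EuclideanSpace ℝ d) ℓ,
            w ℓ y (u t (x + FunctionSpaces.Torus.proj y))) - fun q => L (uncurry u q))
        (ENNReal.ofReal q) ((volume.restrict (Ioo 0 T)).prod volume)) (𝓝[>] 0) (𝓝 0) := by
  have hq0 : 0 < q := one_pos.trans_le hq
  have hlim := tendsto_lintegral_weightedBallAverage_sub hq hu.1
    (lintegral_lt_top_of_memLp_uncurry hq0 hu) hℓ₀ hC hL hw_sub hw_cont hw_bd hw_mass
  have hpow := ((ENNReal.continuous_rpow_const (y := 1 / q)).tendsto 0).comp hlim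
  rw [ENNReal.zero_rpow_of_pos (by positivity)] at hpow
  refine hpow.congr fun ℓ => ?_
  set Φ : ℝ × UnitAddTorus d → G := (uncurry fun t x => ⨍ y in ball (0 : EuclideanSpace ℝ d) ℓ,
      w ℓ y (u t (x + FunctionSpaces.Torus.proj y))) - fun q => L (uncurry u q) with hΦ
  have hm : AEStronglyMeasurable Φ ((volume.restrict (Ioo 0 T)).prod volume) :=
    (aestronglyMeasurable_weightedBallAverage hu.1 (hw_cont ℓ) _).sub (hL.comp_aestronglyMeasurable hu.1)
  simp only [Function.comp_def]
  have hprod : ∫⁻ t in Ioo 0 T, ∫⁻ x,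
      ‖(⨍ y in ball (0 : EuclideanSpace ℝ d) ℓ, w ℓ y (u t (x + FunctionSpaces.Torus.proj y))) -
        L (u t x)‖ₑ ^ q = ∫⁻ z, ‖Φ z‖ₑ ^ q ∂((volume.restrict (Ioo 0 T)).prod volume) :=
    (lintegral_prod _ (hm.enorm.pow_const q)).symm
  rw [hprod, lintegral_enorm_rpow_eq_eLpNorm_rpow hq0, ← ENNReal.rpow_mul, mul_one_div_cancel hq0.ne',
    ENNReal.rpow_one]

end Packaging

/-! ## The four longitudinal averages converge in `L^q((0,T) × T^d)` -/

section FourAverages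

variable [DecidableEq d] [Nonempty d] {T : ℝ} {u : ℝ → UnitAddTorus d → EuclideanSpace ℝ d}
  {p : ℝ → UnitAddTorus d → ℝ}

omit [DecidableEq d] in
/-- **`u_{L,ℓ} → (3/(d+2)) u` in `L³((0,T) × T^d)`** (the (claim) of Novack 2024, §2 Step 2, for
the velocity, `p = 3`), together with `u_{L,ℓ} ∈ L³` for `ℓ > 0`. [cite: Novack2024, Sect. 2 Step 2 (claim)] -/
theorem tendsto_eLpNorm_longAvg_sub
    (hu : MemLp (uncurry u) (ENNReal.ofReal 3) ((volume.restrict (Ioo 0 T)).prod volume)) :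
    (∀ {ℓ : ℝ}, 0 < ℓ → MemLp (uncurry fun t x => longAvg (u t) ℓ x) (ENNReal.ofReal 3)
      ((volume.restrict (Ioo 0 T)).prod volume)) ∧
    Tendsto (fun ℓ : ℝ => eLpNorm ((uncurry fun t x => longAvg (u t) ℓ x) -
        fun q => (3 / ((Fintype.card d : ℝ) + 2)) • uncurry u q) (ENNReal.ofReal 3)
        ((volume.restrict (Ioo 0 T)).prod volume)) (𝓝[>] 0) (𝓝 0) := by
  refine ⟨fun {ℓ} hℓ => ?_, ?_⟩
  · exact memLp_uncurry_weightedBallAverage (w := fun y v =>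
        (1 - ‖y‖ ^ 2 / ℓ ^ 2) • v + (ℓ ^ 2)⁻¹ • ⟪y, v⟫ • y) (by norm_num) hu hℓ zero_le_two
      (continuous_longWeight ℓ) (fun y hy v => norm_longWeight_le hℓ hy v)
  · exact tendsto_eLpNorm_weightedBallAverage_sub (w := fun ℓ y v =>
        (1 - ‖y‖ ^ 2 / ℓ ^ 2) • v + (ℓ ^ 2)⁻¹ • ⟪y, v⟫ • y)
      (L := fun v => (3 / ((Fintype.card d : ℝ) + 2)) • v) (by norm_num) hu one_pos zero_le_two
      (continuous_const_smul _) (fun ℓ y a b => longWeight_sub ℓ y a b) (fun ℓ => continuous_longWeight ℓ)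
      (fun ℓ hℓ y hy v => norm_longWeight_le hℓ.1 hy v) (fun ℓ hℓ v => longWeight_mass hℓ.1 v)

/-- **`(|u_L|²)_ℓ → (3/(d+2)) |u|²` in `L^{3/2}((0,T) × T^d)`** (the (claim) for the quadratic
tensor `uᵢuⱼ ∈ L^{3/2}`, traced), together with `(|u_L|²)_ℓ ∈ L^{3/2}` for `ℓ > 0`. [cite: Novack2024, Sect. 2 Step 2 (claim)] -/
theorem tendsto_eLpNorm_longAvgSq_sub
    (hu : AEStronglyMeasurable (uncurry u) ((volume.restrict (Ioo 0 T)).prod volume))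
    (hS : MemLp (uncurry fun t x => ‖u t x‖ ^ 2) (ENNReal.ofReal (3 / 2))
      ((volume.restrict (Ioo 0 T)).prod volume)) :
    (∀ {ℓ : ℝ}, 0 < ℓ → MemLp (uncurry fun t x => longAvgSq (u t) ℓ x) (ENNReal.ofReal (3 / 2))
      ((volume.restrict (Ioo 0 T)).prod volume)) ∧
    Tendsto (fun ℓ : ℝ => eLpNorm ((uncurry fun t x => longAvgSq (u t) ℓ x) -
        fun q => 3 / ((Fintype.card d : ℝ) + 2) * ‖uncurry u q‖ ^ 2) (ENNReal.ofReal (3 / 2))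
        ((volume.restrict (Ioo 0 T)).prod volume)) (𝓝[>] 0) (𝓝 0) := by
  -- the quadratic tensor field
  set Q : ℝ → UnitAddTorus d → (d → d → ℝ) := fun t x => fun i j => u t x i * u t x j with hQ
  have hQm : AEStronglyMeasurable (uncurry Q) ((volume.restrict (Ioo 0 T)).prod volume) :=
    continuous_sqTensor.comp_aestronglyMeasurable hu
  have hQ32 : MemLp (uncurry Q) (ENNReal.ofReal (3 / 2)) ((volume.restrict (Ioo 0 T)).prod volume) := by
    refine MemLp.of_le_mul hS hQm (c := 1) (ae_of_all _ fun q => ?_)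
    simp only [uncurry, one_mul, Real.norm_eq_abs, abs_pow, abs_norm]
    exact norm_sqTensor_le _
  have hC : (0 : ℝ) ≤ (Fintype.card d : ℝ) + (Fintype.card d : ℝ) ^ 2 := by positivity
  -- the averages coincide
  have heq : ∀ ℓ t x, longAvgSq (u t) ℓ x = ⨍ y in ball (0 : EuclideanSpace ℝ d) ℓ,
      ((1 - ‖y‖ ^ 2 / ℓ ^ 2) • (∑ i, Q t (x + FunctionSpaces.Torus.proj y) i i) +
        (ℓ ^ 2)⁻¹ • ∑ i, ∑ j, (y i * y j) • Q t (x + FunctionSpaces.Torus.proj y) i j) := by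
    intro ℓ t x
    rw [longAvgSq]
    congr 1
    funext y
    rw [hQ, tensorWeight_apply_sq]
  refine ⟨fun {ℓ} hℓ => ?_, ?_⟩
  · have h := memLp_uncurry_weightedBallAverage (w := fun y (Φ : d → d → ℝ) =>
        (1 - ‖y‖ ^ 2 / ℓ ^ 2) • (∑ i, Φ i i) + (ℓ ^ 2)⁻¹ • ∑ i, ∑ j, (y i * y j) • Φ i j)
      (by norm_num) hQ32 hℓ hC (continuous_tensorWeight ℓ) (fun y hy Φ => norm_tensorWeight_le hℓ hy Φ)
    refine h.ae_eq (ae_of_all _ fun q => ?_)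
    simp only [uncurry, heq]
  · have h := tendsto_eLpNorm_weightedBallAverage_sub (w := fun ℓ y (Φ : d → d → ℝ) =>
        (1 - ‖y‖ ^ 2 / ℓ ^ 2) • (∑ i, Φ i i) + (ℓ ^ 2)⁻¹ • ∑ i, ∑ j, (y i * y j) • Φ i j)
      (L := fun Φ : d → d → ℝ => (3 / ((Fintype.card d : ℝ) + 2)) • ∑ i, Φ i i) (by norm_num) hQ32
      one_pos hC (continuous_const_smul_trace _)
      (fun ℓ y a b => tensorWeight_sub ℓ y a b) (fun ℓ => continuous_tensorWeight ℓ)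
      (fun ℓ hℓ y hy Φ => norm_tensorWeight_le hℓ.1 hy Φ) (fun ℓ hℓ Φ => tensorWeight_mass hℓ.1 Φ)
    refine h.congr fun ℓ => ?_
    congr 1
    funext q
    simp only [Pi.sub_apply, uncurry, heq, hQ, trace_sq_smul]

/-- **`(u|u_L|²)_ℓ → (3/(d+2)) |u|² u` in `L¹((0,T) × T^d)`** (the (claim) for the cubic tensor
`uᵢuⱼ u ∈ L¹`, traced), together with `(u|u_L|²)_ℓ ∈ L¹` for `ℓ > 0`. [cite: Novack2024, Sect. 2 Step 2 (claim)] -/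
theorem tendsto_eLpNorm_longAvgCube_sub
    (hu : AEStronglyMeasurable (uncurry u) ((volume.restrict (Ioo 0 T)).prod volume))
    (hW : MemLp (uncurry fun t x => ‖u t x‖ ^ 2 • u t x) (ENNReal.ofReal 1)
      ((volume.restrict (Ioo 0 T)).prod volume)) :
    (∀ {ℓ : ℝ}, 0 < ℓ → MemLp (uncurry fun t x => longAvgCube (u t) ℓ x) (ENNReal.ofReal 1)
      ((volume.restrict (Ioo 0 T)).prod volume)) ∧
    Tendsto (fun ℓ : ℝ => eLpNorm ((uncurry fun t x => longAvgCube (u t) ℓ x) -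
        fun q => (3 / ((Fintype.card d : ℝ) + 2)) • ‖uncurry u q‖ ^ 2 • uncurry u q) (ENNReal.ofReal 1)
        ((volume.restrict (Ioo 0 T)).prod volume)) (𝓝[>] 0) (𝓝 0) := by
  -- the cubic tensor field
  set K : ℝ → UnitAddTorus d → (d → d → EuclideanSpace ℝ d) :=
    fun t x => fun i j => (u t x i * u t x j) • u t x with hK
  have hKm : AEStronglyMeasurable (uncurry K) ((volume.restrict (Ioo 0 T)).prod volume) :=
    continuous_cubeTensor.comp_aestronglyMeasurable hu
  have hK1 : MemLp (uncurry K) (ENNReal.ofReal 1) ((volume.restrict (Ioo 0 T)).prod volume) := by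
    refine MemLp.of_le_mul hW hKm (c := 1) (ae_of_all _ fun q => ?_)
    rw [one_mul]
    refine (norm_cubeTensor_le _).trans (le_of_eq ?_)
    simp only [uncurry, norm_smul, norm_pow, norm_norm]
  have hC : (0 : ℝ) ≤ (Fintype.card d : ℝ) + (Fintype.card d : ℝ) ^ 2 := by positivity
  -- the averages coincide
  have heq : ∀ ℓ t x, longAvgCube (u t) ℓ x = ⨍ y in ball (0 : EuclideanSpace ℝ d) ℓ,
      ((1 - ‖y‖ ^ 2 / ℓ ^ 2) • (∑ i, K t (x + FunctionSpaces.Torus.proj y) i i) +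
        (ℓ ^ 2)⁻¹ • ∑ i, ∑ j, (y i * y j) • K t (x + FunctionSpaces.Torus.proj y) i j) := by
    intro ℓ t x
    rw [longAvgCube]
    congr 1
    funext y
    rw [hK, tensorWeight_apply_cube]
  refine ⟨fun {ℓ} hℓ => ?_, ?_⟩
  · have h := memLp_uncurry_weightedBallAverage (w := fun y (Φ : d → d → EuclideanSpace ℝ d) =>
        (1 - ‖y‖ ^ 2 / ℓ ^ 2) • (∑ i, Φ i i) + (ℓ ^ 2)⁻¹ • ∑ i, ∑ j, (y i * y j) • Φ i j)
      le_rfl hK1 hℓ hC (continuous_tensorWeight ℓ) (fun y hy Φ => norm_tensorWeight_le hℓ hy Φ)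
    refine h.ae_eq (ae_of_all _ fun q => ?_)
    simp only [uncurry, heq]
  · have h := tendsto_eLpNorm_weightedBallAverage_sub (w := fun ℓ y (Φ : d → d → EuclideanSpace ℝ d) =>
        (1 - ‖y‖ ^ 2 / ℓ ^ 2) • (∑ i, Φ i i) + (ℓ ^ 2)⁻¹ • ∑ i, ∑ j, (y i * y j) • Φ i j)
      (L := fun Φ : d → d → EuclideanSpace ℝ d => (3 / ((Fintype.card d : ℝ) + 2)) • ∑ i, Φ i i)
      le_rfl hK1 one_pos hC (continuous_const_smul_trace _)
      (fun ℓ y a b => tensorWeight_sub ℓ y a b) (fun ℓ => continuous_tensorWeight ℓ)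
      (fun ℓ hℓ y hy Φ => norm_tensorWeight_le hℓ.1 hy Φ) (fun ℓ hℓ Φ => tensorWeight_mass hℓ.1 Φ)
    refine h.congr fun ℓ => ?_
    congr 1
    funext q
    simp only [Pi.sub_apply, uncurry, heq, hK, trace_cube_smul]

omit [DecidableEq d] in
/-- **`p_{L,ℓ} → (3/(d+2)) p` in `L^{3/2}((0,T) × T^d)`** ("computing similarly for `p_{L,ℓ}`"),
together with `p_{L,ℓ} ∈ L^{3/2}` for `ℓ > 0`. [cite: Novack2024, Sect. 2 Step 2 (claim)] -/
theorem tendsto_eLpNorm_longAvgPressure_sub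
    (hp : MemLp (uncurry p) (ENNReal.ofReal (3 / 2)) ((volume.restrict (Ioo 0 T)).prod volume)) :
    (∀ {ℓ : ℝ}, 0 < ℓ → MemLp (uncurry fun t x => longAvgPressure d (p t) ℓ x) (ENNReal.ofReal (3 / 2))
      ((volume.restrict (Ioo 0 T)).prod volume)) ∧
    Tendsto (fun ℓ : ℝ => eLpNorm ((uncurry fun t x => longAvgPressure d (p t) ℓ x) -
        fun q => 3 / ((Fintype.card d : ℝ) + 2) * uncurry p q) (ENNReal.ofReal (3 / 2))
        ((volume.restrict (Ioo 0 T)).prod volume)) (𝓝[>] 0) (𝓝 0) := by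
  have hC : (0 : ℝ) ≤ 1 + |((Fintype.card d : ℝ) - 1) / 2| := by positivity
  refine ⟨fun {ℓ} hℓ => ?_, ?_⟩
  · exact memLp_uncurry_weightedBallAverage (w := fun y a =>
        (1 - ((Fintype.card d : ℝ) - 1) / 2 * (1 - ‖y‖ ^ 2 / ℓ ^ 2)) * a) (by norm_num) hp hℓ hC
      (by fun_prop) (fun y hy a => norm_pressureWeight_le hℓ hy a)
  · exact tendsto_eLpNorm_weightedBallAverage_sub (w := fun ℓ y a =>
        (1 - ((Fintype.card d : ℝ) - 1) / 2 * (1 - ‖y‖ ^ 2 / ℓ ^ 2)) * a)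
      (L := fun a => 3 / ((Fintype.card d : ℝ) + 2) * a) (by norm_num) hp one_pos hC
      (continuous_const.mul continuous_id) (fun ℓ y a b => mul_sub _ _ _) (fun ℓ => by fun_prop)
      (fun ℓ hℓ y hy a => norm_pressureWeight_le hℓ.1 hy a) (fun ℓ hℓ a => pressureWeight_mass hℓ.1 a)

end FourAverages

/-! ## The discharge -/

section Discharge

/-- **Discharge of `novack2024_longAvg_balance_tendsto`** (Novack 2024, §2 Step 2: the limit
`ℓ → 0` of the scale-`ℓ` longitudinal balance (last:one:L:L), through the (claim)
`‖g_{L,ℓ} − (3/(d+2)) g‖_p → 0`): see the module docstring. [cite: Novack2024, Sect. 2 Step 2 (claim) and limit ℓ → 0] -/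
theorem novack2024_longAvg_balance_tendsto_holds : novack2024_longAvg_balance_tendsto (d := d) := by
  intro _ T u₀ u p hd hT hsol hC hu3 hp hu₀ ψ hψ
  haveI : Nonempty d := Fintype.card_pos_iff.1 (by omega)
  haveI := holderTriple_three_threeHalves
  haveI : ENNReal.HolderTriple (3 / 2 : ℝ≥0∞) 3 1 :=
    ⟨by rw [add_comm]; exact holderTriple_three_threeHalves.inv_add_inv_eq_inv⟩
  set c : ℝ := 3 / ((Fintype.card d : ℝ) + 2) with hc
  set μp : Measure (ℝ × UnitAddTorus d) := (volume.restrict (Ioo 0 T)).prod volume with hμp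
  haveI : IsFiniteMeasure μp := by rw [hμp]; infer_instance
  -- measurability of `u`, `p`
  have hum : AEStronglyMeasurable (uncurry u) μp := aestronglyMeasurable_uncurry_prod_of_stLift_Ioo hsol.1
  have hpm : AEStronglyMeasurable (uncurry p) μp := by
    have h := FunctionSpaces.Torus.aestronglyMeasurable_uncurry_of_stLift_restrict hsol.2.2.1
    rwa [Measure.volume_eq_prod, ← Measure.prod_restrict, Measure.restrict_univ] at h
  -- exponents
  have e3 : ENNReal.ofReal 3 = 3 := by norm_num
  have e32 : ENNReal.ofReal (3 / 2) = 3 / 2 := by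
    rw [ENNReal.ofReal_div_of_pos (by norm_num)]; norm_num
  have e1 : ENNReal.ofReal 1 = 1 := ENNReal.ofReal_one
  -- `u ∈ L³`, `p ∈ L^{3/2}` on the product
  have hU3r : MemLp (uncurry u) (ENNReal.ofReal 3) μp := by
    refine memLp_uncurry_of_lintegral (by norm_num) hum ?_
    have h3 : ∀ x : ℝ≥0∞, x ^ (3 : ℝ) = x ^ (3 : ℕ) := fun x => by
      rw [← ENNReal.rpow_natCast]; norm_num
    simpa only [h3] using hu3
  have hU3 : MemLp (uncurry u) 3 μp := e3 ▸ hU3r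
  have h32le3 : (3 / 2 : ℝ≥0∞) ≤ 3 := by
    rw [ENNReal.div_le_iff (by norm_num) (by norm_num)]; norm_num
  have hU32 : MemLp (uncurry u) (3 / 2) μp := hU3.mono_exponent h32le3
  have hP32r : MemLp (uncurry p) (ENNReal.ofReal (3 / 2)) μp := memLp_uncurry_of_lintegral (by norm_num) hpm hp
  have hP32 : MemLp (uncurry p) (3 / 2) μp := e32 ▸ hP32r
  -- the cubic and quadratic fields
  set W : ℝ → UnitAddTorus d → EuclideanSpace ℝ d := fun t x => ‖u t x‖ ^ 2 • u t x with hW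
  set S : ℝ → UnitAddTorus d → ℝ := fun t x => ‖u t x‖ ^ 2 with hS
  have hWm : AEStronglyMeasurable (uncurry W) μp := (hum.norm.pow 2).smul hum
  have hSm : AEStronglyMeasurable (uncurry S) μp := hum.norm.pow 2
  have hW1r : MemLp (uncurry W) (ENNReal.ofReal 1) μp := by
    rw [e1, memLp_one_iff_integrable]
    have hint : Integrable (fun q => ‖uncurry u q‖ ^ (3 : ℝ)) μp := by
      simpa using hU3.integrable_norm_rpow (by norm_num) (by norm_num)
    refine hint.mono' hWm (ae_of_all _ fun q => ?_)
    have h3 : ‖uncurry u q‖ ^ (3 : ℝ) = ‖uncurry u q‖ ^ (3 : ℕ) := by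
      rw [← Real.rpow_natCast]; norm_num
    simp only [hW, uncurry, norm_smul, norm_pow, norm_norm, h3] at *
    exact le_of_eq (by ring)
  have hS32r : MemLp (uncurry S) (ENNReal.ofReal (3 / 2)) μp := by
    have h := hU3.norm_rpow_div (2 : ℝ≥0∞)
    have hexp : (3 : ℝ≥0∞) / 2 = ENNReal.ofReal (3 / 2) := by rw [e32]
    rw [hexp] at h
    refine h.ae_eq (ae_of_all _ fun q => ?_)
    simp [hS, uncurry]
  have hS32 : MemLp (uncurry S) (3 / 2) μp := e32 ▸ hS32r
  have hW1 : MemLp (uncurry W) 1 μp := e1 ▸ hW1r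
  -- the limits `c u`, `c |u|²u`, `c |u|²`, `c p`
  have hcU3 : MemLp (fun q => c • uncurry u q) 3 μp := hU3.const_smul c
  have hcW1 : MemLp (fun q => c • uncurry W q) 1 μp := hW1.const_smul c
  have hcS32 : MemLp (fun q => c * uncurry S q) (3 / 2) μp := hS32.const_mul c
  have hcP32 : MemLp (fun q => c * uncurry p q) (3 / 2) μp := hP32.const_mul c
  -- longitudinal averages: membership and convergence
  obtain ⟨hUℓ', hUt'⟩ := tendsto_eLpNorm_longAvg_sub hU3r
  obtain ⟨hSℓ', hSt'⟩ := tendsto_eLpNorm_longAvgSq_sub hum hS32r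
  obtain ⟨hWℓ', hWt'⟩ := tendsto_eLpNorm_longAvgCube_sub hum hW1r
  obtain ⟨hPℓ', hPt'⟩ := tendsto_eLpNorm_longAvgPressure_sub (d := d) hP32r
  have hUℓ : ∀ {ℓ : ℝ}, 0 < ℓ → MemLp (uncurry fun t x => longAvg (u t) ℓ x) 3 μp :=
    fun hℓ => e3 ▸ hUℓ' hℓ
  have hPℓ : ∀ {ℓ : ℝ}, 0 < ℓ → MemLp (uncurry fun t x => longAvgPressure d (p t) ℓ x) (3 / 2) μp :=
    fun hℓ => e32 ▸ hPℓ' hℓ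
  have hWℓ : ∀ {ℓ : ℝ}, 0 < ℓ → MemLp (uncurry fun t x => longAvgCube (u t) ℓ x) 1 μp :=
    fun hℓ => e1 ▸ hWℓ' hℓ
  have hSℓ : ∀ {ℓ : ℝ}, 0 < ℓ → MemLp (uncurry fun t x => longAvgSq (u t) ℓ x) (3 / 2) μp :=
    fun hℓ => e32 ▸ hSℓ' hℓ
  have hUt : Tendsto (fun ℓ : ℝ => eLpNorm ((uncurry fun t x => longAvg (u t) ℓ x) -
      fun q => c • uncurry u q) 3 μp) (𝓝[>] 0) (𝓝 0) := e3 ▸ hUt'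
  have hPt : Tendsto (fun ℓ : ℝ => eLpNorm ((uncurry fun t x => longAvgPressure d (p t) ℓ x) -
      fun q => c * uncurry p q) (3 / 2) μp) (𝓝[>] 0) (𝓝 0) := e32 ▸ hPt'
  have hWt : Tendsto (fun ℓ : ℝ => eLpNorm ((uncurry fun t x => longAvgCube (u t) ℓ x) -
      fun q => c • uncurry W q) 1 μp) (𝓝[>] 0) (𝓝 0) := e1 ▸ hWt'
  have hSt : Tendsto (fun ℓ : ℝ => eLpNorm ((uncurry fun t x => longAvgSq (u t) ℓ x) -
      fun q => c * uncurry S q) (3 / 2) μp) (𝓝[>] 0) (𝓝 0) := e32 ▸ hSt'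
  -- the test function: `∂ₜψ`, `∇ψ` continuous and bounded on `[0,T] × T^d`
  have hψT : FunctionSpaces.Torus.IsSpaceTimeTest T ψ := hψ.1
  have hψtc : Continuous (uncurry (FunctionSpaces.Torus.timeDeriv ψ)) := hψT.continuous_uncurry_timeDeriv
  have hψgc : Continuous (uncurry fun t x => FunctionSpaces.Torus.gradient (ψ t) x) :=
    hψT.continuous_uncurry_gradient
  obtain ⟨Ct, hCt⟩ := exists_bound_of_continuous_uncurry hψtc 0 T
  obtain ⟨Cg, hCg⟩ := exists_bound_of_continuous_uncurry hψgc 0 T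
  have hIoo : ∀ᵐ q ∂μp, q.1 ∈ Ioo 0 T :=
    (Measure.quasiMeasurePreserving_fst (μ := volume.restrict (Ioo 0 T))
      (ν := (volume : Measure (UnitAddTorus d)))).ae (ae_restrict_mem measurableSet_Ioo)
  have hψtm : AEStronglyMeasurable (uncurry (FunctionSpaces.Torus.timeDeriv ψ)) μp :=
    hψtc.aestronglyMeasurable
  have hψgm : AEStronglyMeasurable (uncurry fun t x => FunctionSpaces.Torus.gradient (ψ t) x) μp :=
    hψgc.aestronglyMeasurable
  have hψtb : ∀ᵐ q ∂μp, ‖uncurry (FunctionSpaces.Torus.timeDeriv ψ) q‖ ≤ Ct := by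
    filter_upwards [hIoo] with q hq; exact hCt q.1 (Ioo_subset_Icc_self hq) q.2
  have hψgb : ∀ᵐ q ∂μp, ‖uncurry (fun t x => FunctionSpaces.Torus.gradient (ψ t) x) q‖ ≤ Cg := by
    filter_upwards [hIoo] with q hq; exact hCg q.1 (Ioo_subset_Icc_self hq) q.2
  have h1m : AEStronglyMeasurable (fun _ : ℝ × UnitAddTorus d => (1 : ℝ)) μp := aestronglyMeasurable_const
  have h1b : ∀ᵐ q ∂μp, ‖(fun _ : ℝ × UnitAddTorus d => (1 : ℝ)) q‖ ≤ 1 := ae_of_all _ fun _ => by simp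
  -- the inner product as a bounded bilinear form
  set βI : EuclideanSpace ℝ d →L[ℝ] EuclideanSpace ℝ d →L[ℝ] ℝ := innerSL ℝ with hβIdef
  have hβI : ∀ v w : EuclideanSpace ℝ d, βI v w = ⟪v, w⟫ := fun v w => rfl
  -- the fixed second factors
  set B₂ : ℝ × UnitAddTorus d → EuclideanSpace ℝ d :=
    fun q => (inner ℝ (uncurry u q) (FunctionSpaces.Torus.gradient (ψ q.1) q.2)) • uncurry u q with hB₂def
  set B₄ : ℝ × UnitAddTorus d → ℝ :=
    fun q => inner ℝ (uncurry u q) (FunctionSpaces.Torus.gradient (ψ q.1) q.2) with hB₄def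
  set B₅ : ℝ × UnitAddTorus d → EuclideanSpace ℝ d :=
    fun q => uncurry p q • FunctionSpaces.Torus.gradient (ψ q.1) q.2 with hB₅def
  have hB₄m : AEStronglyMeasurable B₄ μp := hum.inner hψgm
  have hB₄ : MemLp B₄ 3 μp := by
    refine MemLp.of_le_mul hU3 hB₄m (c := Cg) ?_
    filter_upwards [hψgb] with q hq
    rw [hB₄def, Real.norm_eq_abs]
    calc |⟪uncurry u q, FunctionSpaces.Torus.gradient (ψ q.1) q.2⟫|
        ≤ ‖uncurry u q‖ * ‖FunctionSpaces.Torus.gradient (ψ q.1) q.2‖ := abs_real_inner_le_norm _ _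
      _ ≤ ‖uncurry u q‖ * Cg := by gcongr; exact hq
      _ = Cg * ‖uncurry u q‖ := mul_comm _ _
  have hB₂ : MemLp B₂ (3 / 2) μp := by
    refine MemLp.of_le_mul hS32 (hB₄m.smul hum) (c := Cg) ?_
    filter_upwards [hψgb] with q hq
    rw [hB₂def, norm_smul, Real.norm_eq_abs, hS]
    simp only [uncurry, Real.norm_eq_abs, abs_pow, abs_norm]
    calc |⟪u q.1 q.2, FunctionSpaces.Torus.gradient (ψ q.1) q.2⟫| * ‖u q.1 q.2‖
        ≤ ‖u q.1 q.2‖ * Cg * ‖u q.1 q.2‖ := by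
          gcongr
          exact (abs_real_inner_le_norm _ _).trans (by gcongr; exact hq)
      _ = Cg * ‖u q.1 q.2‖ ^ 2 := by ring
  have hB₃ : MemLp (uncurry fun t x => FunctionSpaces.Torus.gradient (ψ t) x) ⊤ μp :=
    memLp_top_of_bound hψgm Cg hψgb
  have hB₅ : MemLp B₅ (3 / 2) μp := by
    refine MemLp.of_le_mul hP32 (hpm.smul hψgm) (c := Cg) ?_
    filter_upwards [hψgb] with q hq
    rw [hB₅def, norm_smul]
    calc ‖uncurry p q‖ * ‖FunctionSpaces.Torus.gradient (ψ q.1) q.2‖ ≤ ‖uncurry p q‖ * Cg := by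
          gcongr; exact hq
      _ = Cg * ‖uncurry p q‖ := mul_comm _ _
  -- eventual memberships of the moving factors
  have evU : ∀ᶠ ℓ in 𝓝[>] (0 : ℝ), MemLp (uncurry fun t x => longAvg (u t) ℓ x) 3 μp :=
    eventually_mem_nhdsWithin.mono fun ℓ hℓ => hUℓ hℓ
  have evP : ∀ᶠ ℓ in 𝓝[>] (0 : ℝ), MemLp (uncurry fun t x => longAvgPressure d (p t) ℓ x) (3 / 2) μp :=
    eventually_mem_nhdsWithin.mono fun ℓ hℓ => hPℓ hℓ
  have evW : ∀ᶠ ℓ in 𝓝[>] (0 : ℝ), MemLp (uncurry fun t x => longAvgCube (u t) ℓ x) 1 μp :=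
    eventually_mem_nhdsWithin.mono fun ℓ hℓ => hWℓ hℓ
  have evS : ∀ᶠ ℓ in 𝓝[>] (0 : ℝ), MemLp (uncurry fun t x => longAvgSq (u t) ℓ x) (3 / 2) μp :=
    eventually_mem_nhdsWithin.mono fun ℓ hℓ => hSℓ hℓ
  -- the six limits, in product form
  have h332 : (1 : ℝ≥0∞) ≤ 3 / 2 := by
    rw [ENNReal.le_div_iff_mul_le (by norm_num) (by norm_num)]; norm_num
  have T1 := tendsto_integral_mul_bilin_of_tendsto_eLpNorm (μ := μp) (p := 3) (q := 3 / 2) h332 βI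
    evU hcU3 hU32 hUt hψtm hψtb
  have T2 := tendsto_integral_mul_bilin_of_tendsto_eLpNorm (μ := μp) (p := 3) (q := 3 / 2) h332 βI
    evU hcU3 hB₂ hUt h1m h1b
  have T3 := tendsto_integral_mul_bilin_of_tendsto_eLpNorm (μ := μp) (p := 1) (q := ⊤) le_top
    βI evW hcW1 hB₃ hWt h1m h1b
  have T4 := tendsto_integral_mul_bilin_of_tendsto_eLpNorm (μ := μp) (p := 3 / 2) (q := 3)
    (by norm_num) (ContinuousLinearMap.mul ℝ ℝ) evS hcS32 hB₄ hSt h1m h1b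
  have T5 := tendsto_integral_mul_bilin_of_tendsto_eLpNorm (μ := μp) (p := 3) (q := 3 / 2) h332 βI
    evU hcU3 hB₅ hUt h1m h1b
  have T6 := tendsto_integral_mul_bilin_of_tendsto_eLpNorm (μ := μp) (p := 3 / 2) (q := 3)
    (by norm_num) (ContinuousLinearMap.mul ℝ ℝ) evP hcP32 hB₄ hPt h1m h1b
  -- iterated integrals of `novackLongPairing` in product form
  have conv1 : ∀ {ℓ : ℝ}, 0 < ℓ →
      ∫ t in Ioo 0 T, ∫ x, ⟪u t x, longAvg (u t) ℓ x⟫ * FunctionSpaces.Torus.timeDeriv ψ t x =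
        ∫ q, uncurry (FunctionSpaces.Torus.timeDeriv ψ) q *
          βI ((uncurry fun t x => longAvg (u t) ℓ x) q) (uncurry u q) ∂μp := by
    intro ℓ hℓ
    have hint := integrable_mul_bilin_of_memLp (μ := μp) βI (hUℓ hℓ) hU32 hψtm hψtb
    rw [integral_prod _ hint]
    refine integral_congr_ae (ae_of_all _ fun t => integral_congr_ae (ae_of_all _ fun x => ?_))
    simp only [uncurry, hβI]
    rw [real_inner_comm, mul_comm]
  have conv2 : ∀ {ℓ : ℝ}, 0 < ℓ →
      ∫ t in Ioo 0 T, ∫ x, ⟪u t x, longAvg (u t) ℓ x⟫ * ⟪u t x, FunctionSpaces.Torus.gradient (ψ t) x⟫ =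
        ∫ q, (fun _ : ℝ × UnitAddTorus d => (1 : ℝ)) q *
          βI ((uncurry fun t x => longAvg (u t) ℓ x) q) (B₂ q) ∂μp := by
    intro ℓ hℓ
    have hint := integrable_mul_bilin_of_memLp (μ := μp) βI (hUℓ hℓ) hB₂ h1m h1b
    rw [integral_prod _ hint]
    refine integral_congr_ae (ae_of_all _ fun t => integral_congr_ae (ae_of_all _ fun x => ?_))
    simp only [uncurry, hβI, hB₂def, one_mul, inner_smul_right]
    rw [real_inner_comm (u t x)]
    ring
  have conv3 : ∀ {ℓ : ℝ}, 0 < ℓ →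
      ∫ t in Ioo 0 T, ∫ x, ⟪longAvgCube (u t) ℓ x, FunctionSpaces.Torus.gradient (ψ t) x⟫ =
        ∫ q, (fun _ : ℝ × UnitAddTorus d => (1 : ℝ)) q *
          βI ((uncurry fun t x => longAvgCube (u t) ℓ x) q)
            ((uncurry fun t x => FunctionSpaces.Torus.gradient (ψ t) x) q) ∂μp := by
    intro ℓ hℓ
    have hint := integrable_mul_bilin_of_memLp (μ := μp) βI (hWℓ hℓ) hB₃ h1m h1b
    rw [integral_prod _ hint]
    refine integral_congr_ae (ae_of_all _ fun t => integral_congr_ae (ae_of_all _ fun x => ?_))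
    simp only [uncurry, hβI, one_mul]
  have conv4 : ∀ {ℓ : ℝ}, 0 < ℓ →
      ∫ t in Ioo 0 T, ∫ x, longAvgSq (u t) ℓ x * ⟪u t x, FunctionSpaces.Torus.gradient (ψ t) x⟫ =
        ∫ q, (fun _ : ℝ × UnitAddTorus d => (1 : ℝ)) q *
          ContinuousLinearMap.mul ℝ ℝ ((uncurry fun t x => longAvgSq (u t) ℓ x) q) (B₄ q) ∂μp := by
    intro ℓ hℓ
    have hint := integrable_mul_bilin_of_memLp (μ := μp) (ContinuousLinearMap.mul ℝ ℝ) (hSℓ hℓ) hB₄ h1m h1b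
    rw [integral_prod _ hint]
    refine integral_congr_ae (ae_of_all _ fun t => integral_congr_ae (ae_of_all _ fun x => ?_))
    simp only [uncurry, ContinuousLinearMap.mul_apply', one_mul, hB₄def]
  have conv5 : ∀ {ℓ : ℝ}, 0 < ℓ →
      ∫ t in Ioo 0 T, ∫ x, p t x * ⟪longAvg (u t) ℓ x, FunctionSpaces.Torus.gradient (ψ t) x⟫ =
        ∫ q, (fun _ : ℝ × UnitAddTorus d => (1 : ℝ)) q *
          βI ((uncurry fun t x => longAvg (u t) ℓ x) q) (B₅ q) ∂μp := by
    intro ℓ hℓ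
    have hint := integrable_mul_bilin_of_memLp (μ := μp) βI (hUℓ hℓ) hB₅ h1m h1b
    rw [integral_prod _ hint]
    refine integral_congr_ae (ae_of_all _ fun t => integral_congr_ae (ae_of_all _ fun x => ?_))
    simp only [uncurry, hβI, hB₅def, one_mul, inner_smul_right]
  have conv6 : ∀ {ℓ : ℝ}, 0 < ℓ →
      ∫ t in Ioo 0 T, ∫ x, longAvgPressure d (p t) ℓ x * ⟪u t x, FunctionSpaces.Torus.gradient (ψ t) x⟫ =
        ∫ q, (fun _ : ℝ × UnitAddTorus d => (1 : ℝ)) q *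
          ContinuousLinearMap.mul ℝ ℝ ((uncurry fun t x => longAvgPressure d (p t) ℓ x) q) (B₄ q) ∂μp := by
    intro ℓ hℓ
    have hint := integrable_mul_bilin_of_memLp (μ := μp) (ContinuousLinearMap.mul ℝ ℝ) (hPℓ hℓ) hB₄ h1m h1b
    rw [integral_prod _ hint]
    refine integral_congr_ae (ae_of_all _ fun t => integral_congr_ae (ae_of_all _ fun x => ?_))
    simp only [uncurry, ContinuousLinearMap.mul_apply', one_mul, hB₄def]
  -- identification of the limits: everything is `c` times the ball-kernel limits
  have hf1 := integrable_mul_bilin_of_memLp (μ := μp) βI hU3 hU32 hψtm hψtb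
  have hf2 := integrable_mul_bilin_of_memLp (μ := μp) βI hU3 hB₂ h1m h1b
  have hf5 := integrable_mul_bilin_of_memLp (μ := μp) βI hU3 hB₅ h1m h1b
  have hL1 : ∫ q, uncurry (FunctionSpaces.Torus.timeDeriv ψ) q * βI (c • uncurry u q) (uncurry u q) ∂μp =
      c * ∫ q, uncurry (FunctionSpaces.Torus.timeDeriv ψ) q * βI (uncurry u q) (uncurry u q) ∂μp := by
    rw [← integral_const_mul]
    refine integral_congr_ae (ae_of_all _ fun q => ?_)
    simp only [hβI, real_inner_smul_left]
    ring
  have hL2 : ∫ q, (fun _ : ℝ × UnitAddTorus d => (1 : ℝ)) q * βI (c • uncurry u q) (B₂ q) ∂μp =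
      c * ∫ q, (fun _ : ℝ × UnitAddTorus d => (1 : ℝ)) q * βI (uncurry u q) (B₂ q) ∂μp := by
    rw [← integral_const_mul]
    refine integral_congr_ae (ae_of_all _ fun q => ?_)
    simp only [hβI, real_inner_smul_left]
    ring
  have hL3 : ∫ q, (fun _ : ℝ × UnitAddTorus d => (1 : ℝ)) q *
        βI (c • uncurry W q) ((uncurry fun t x => FunctionSpaces.Torus.gradient (ψ t) x) q) ∂μp =
      c * ∫ q, (fun _ : ℝ × UnitAddTorus d => (1 : ℝ)) q * βI (uncurry u q) (B₂ q) ∂μp := by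
    rw [← integral_const_mul]
    refine integral_congr_ae (ae_of_all _ fun q => ?_)
    simp only [uncurry, hβI, hW, hB₂def, one_mul, inner_smul_right, real_inner_smul_left,
      real_inner_self_eq_norm_sq]
    ring
  have hL4 : ∫ q, (fun _ : ℝ × UnitAddTorus d => (1 : ℝ)) q *
        ContinuousLinearMap.mul ℝ ℝ (c * uncurry S q) (B₄ q) ∂μp =
      c * ∫ q, (fun _ : ℝ × UnitAddTorus d => (1 : ℝ)) q * βI (uncurry u q) (B₂ q) ∂μp := by
    rw [← integral_const_mul]
    refine integral_congr_ae (ae_of_all _ fun q => ?_)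
    simp only [uncurry, hβI, ContinuousLinearMap.mul_apply', hS, hB₂def, hB₄def, one_mul,
      inner_smul_right, real_inner_self_eq_norm_sq]
    ring
  have hL5 : ∫ q, (fun _ : ℝ × UnitAddTorus d => (1 : ℝ)) q * βI (c • uncurry u q) (B₅ q) ∂μp =
      c * ∫ q, (fun _ : ℝ × UnitAddTorus d => (1 : ℝ)) q * βI (uncurry u q) (B₅ q) ∂μp := by
    rw [← integral_const_mul]
    refine integral_congr_ae (ae_of_all _ fun q => ?_)
    simp only [hβI, real_inner_smul_left]
    ring
  have hL6 : ∫ q, (fun _ : ℝ × UnitAddTorus d => (1 : ℝ)) q *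
        ContinuousLinearMap.mul ℝ ℝ (c * uncurry p q) (B₄ q) ∂μp =
      c * ∫ q, (fun _ : ℝ × UnitAddTorus d => (1 : ℝ)) q * βI (uncurry u q) (B₅ q) ∂μp := by
    rw [← integral_const_mul]
    refine integral_congr_ae (ae_of_all _ fun q => ?_)
    simp only [uncurry, hβI, ContinuousLinearMap.mul_apply', hB₄def, hB₅def, one_mul,
      inner_smul_right]
    ring
  -- the target in product form
  have htarget : ∫ t in Ioo 0 T, ∫ x,
      (2 * (‖u t x‖ ^ 2 * FunctionSpaces.Torus.timeDeriv ψ t x) +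
        2 * (‖u t x‖ ^ 2 * ⟪u t x, FunctionSpaces.Torus.gradient (ψ t) x⟫) +
        4 * (p t x * ⟪u t x, FunctionSpaces.Torus.gradient (ψ t) x⟫)) =
      2 * (∫ q, uncurry (FunctionSpaces.Torus.timeDeriv ψ) q * βI (uncurry u q) (uncurry u q) ∂μp) +
      2 * (∫ q, (fun _ : ℝ × UnitAddTorus d => (1 : ℝ)) q * βI (uncurry u q) (B₂ q) ∂μp) +
      4 * (∫ q, (fun _ : ℝ × UnitAddTorus d => (1 : ℝ)) q * βI (uncurry u q) (B₅ q) ∂μp) := by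
    have hf1c : Integrable (fun q => 2 * (uncurry (FunctionSpaces.Torus.timeDeriv ψ) q *
        βI (uncurry u q) (uncurry u q))) μp := hf1.const_mul 2
    have hf2c : Integrable (fun q => 2 * ((fun _ : ℝ × UnitAddTorus d => (1 : ℝ)) q *
        βI (uncurry u q) (B₂ q))) μp := hf2.const_mul 2
    have hf5c : Integrable (fun q => 4 * ((fun _ : ℝ × UnitAddTorus d => (1 : ℝ)) q *
        βI (uncurry u q) (B₅ q))) μp := hf5.const_mul 4
    have h12 : Integrable (fun q => 2 * (uncurry (FunctionSpaces.Torus.timeDeriv ψ) q *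
        βI (uncurry u q) (uncurry u q)) +
        2 * ((fun _ : ℝ × UnitAddTorus d => (1 : ℝ)) q * βI (uncurry u q) (B₂ q))) μp := hf1c.add hf2c
    have hsum : Integrable (fun q => 2 * (uncurry (FunctionSpaces.Torus.timeDeriv ψ) q *
        βI (uncurry u q) (uncurry u q)) +
        2 * ((fun _ : ℝ × UnitAddTorus d => (1 : ℝ)) q * βI (uncurry u q) (B₂ q)) +
        4 * ((fun _ : ℝ × UnitAddTorus d => (1 : ℝ)) q * βI (uncurry u q) (B₅ q))) μp := h12.add hf5c
    have hrhs : 2 * (∫ q, uncurry (FunctionSpaces.Torus.timeDeriv ψ) q * βI (uncurry u q) (uncurry u q) ∂μp) +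
        2 * (∫ q, (fun _ : ℝ × UnitAddTorus d => (1 : ℝ)) q * βI (uncurry u q) (B₂ q) ∂μp) +
        4 * (∫ q, (fun _ : ℝ × UnitAddTorus d => (1 : ℝ)) q * βI (uncurry u q) (B₅ q) ∂μp) =
        ∫ q, (2 * (uncurry (FunctionSpaces.Torus.timeDeriv ψ) q * βI (uncurry u q) (uncurry u q)) +
          2 * ((fun _ : ℝ × UnitAddTorus d => (1 : ℝ)) q * βI (uncurry u q) (B₂ q)) +
          4 * ((fun _ : ℝ × UnitAddTorus d => (1 : ℝ)) q * βI (uncurry u q) (B₅ q))) ∂μp := by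
      rw [integral_add h12 hf5c, integral_add hf1c hf2c,
        integral_const_mul (2 : ℝ) (fun q => uncurry (FunctionSpaces.Torus.timeDeriv ψ) q *
          βI (uncurry u q) (uncurry u q)),
        integral_const_mul (2 : ℝ) (fun q => (fun _ : ℝ × UnitAddTorus d => (1 : ℝ)) q *
          βI (uncurry u q) (B₂ q)),
        integral_const_mul (4 : ℝ) (fun q => (fun _ : ℝ × UnitAddTorus d => (1 : ℝ)) q *
          βI (uncurry u q) (B₅ q))]
    rw [hrhs, integral_prod _ hsum]
    refine integral_congr_ae (ae_of_all _ fun t => integral_congr_ae (ae_of_all _ fun x => ?_))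
    simp only [uncurry, hβI, hB₂def, hB₅def, one_mul, inner_smul_right,
      real_inner_self_eq_norm_sq]
    ring
  -- assembly
  have hlim := (((((T1.const_mul 2).add (T2.const_mul 2)).add T3).sub T4).add (T5.const_mul 2)).add
    (T6.const_mul 2)
  rw [hL1, hL2, hL3, hL4, hL5, hL6] at hlim
  rw [htarget]
  have hval : ∀ a b e : ℝ, 2 * (c * a) + 2 * (c * b) + c * b - c * b + 2 * (c * e) + 2 * (c * e) =
      c * (2 * a + 2 * b + 4 * e) := fun a b e => by ring
  rw [hval] at hlim
  refine hlim.congr' ?_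
  filter_upwards [eventually_mem_nhdsWithin] with ℓ hℓ
  rw [novackLongPairing, conv1 hℓ, conv2 hℓ, conv3 hℓ, conv4 hℓ, conv5 hℓ, conv6 hℓ]

end Discharge

end Literature.Analysis.FluidPDE.Torus
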